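import Summits.Ventures.PercRepro.RankLevelSetLevelFiveCqFourteenModulo
import Summits.Ventures.PercRepro.S2RowStep
import Summits.Ventures.PercRepro.S2LPCoreP13D21
import Summits.Ventures.PercRepro.S2LPCoreP13D22
import Summits.Ventures.PercRepro.S2LPCoreP13D23
import Summits.Ventures.PercRepro.S2LPCoreP13D24
import Summits.Ventures.PercRepro.S2LPCoreP13D25
import Summits.Ventures.PercRepro.S2LPCoreP13D26
import Summits.Ventures.PercRepro.S2LPCoreP13D27
import Summits.Ventures.PercRepro.S2LPCoreP13D28
import Summits.Ventures.PercRepro.S2LPCoreP13D29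
import Summits.Ventures.PercRepro.S2LPCoreP13D30

/-!
# PercRepro — THEOREM C₅ AT EVERY `p ≥ 14` (p7, gen 20; sub-claim S2): THE `p = 13` ROW IS CLOSED

The ten cells `(13, 21 … 30)` are the LP-certificate cells `S2LP.c025_core_five_thirteen_{twentyone, …, thirty}` (p2's exact
certificates, the wrappers in SUBCLAIM-S2's cell form); with `c025_core_five_thirteen_all_of_ten_cells` the whole `p = 13` row of the
`e`-free core is a theorem, **`c025_core_five_thirteen_all (M) [M.Finite] (hR : ρ(E) = 13) (hbig : 13 + 5 < |E|) (hfree) : RLS M 13 5`**,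
and with the row step (`c025_five_large_of_rows 14`, the rows `13` and `14`, Theorem C₅ at `15`) Theorem C₅ holds at every `p ≥ 14`
unconditionally: **`c025_five_large_sharp14 (M) [M.Finite] (p) (hp : 14 ≤ p) : RLS M p 5`**. No window move is claimed here (the window
of record stays `8 ≤ p ≤ 14` until the lead moves it). Axioms: standard.
-/

open scoped Matroid

namespace PercRepro

namespace ThmN

variable {α : Type}

/-- The cells `(13, 21 … 30)` of the `p = 13` row, dispatched by `d` (p2's LP-certificate cells). -/
theorem c025_core_five_thirteen_mid (M : Matroid α) [M.Finite] (d : ℕ) (hd21 : 21 ≤ d) (hd30 : d ≤ 30)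
    (hR : M.eRank = ((13 : ℕ) : ℕ∞)) (hn : M.E.ncard = 13 + d)
    (hfree : ∀ e ∈ M.E, ∃ A ⊆ M.E \ {e}, e ∉ M.closure A ∧ e ∉ M.closure ((M.E \ {e}) \ A)) : RLS M 13 5 := by
  interval_cases d
  · exact S2LP.c025_core_five_thirteen_twentyone M hR hn hfree
  · exact S2LP.c025_core_five_thirteen_twentytwo M hR hn hfree
  · exact S2LP.c025_core_five_thirteen_twentythree M hR hn hfree
  · exact S2LP.c025_core_five_thirteen_twentyfour M hR hn hfree
  · exact S2LP.c025_core_five_thirteen_twentyfive M hR hn hfree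
  · exact S2LP.c025_core_five_thirteen_twentysix M hR hn hfree
  · exact S2LP.c025_core_five_thirteen_twentyseven M hR hn hfree
  · exact S2LP.c025_core_five_thirteen_twentyeight M hR hn hfree
  · exact S2LP.c025_core_five_thirteen_twentynine M hR hn hfree
  · exact S2LP.c025_core_five_thirteen_thirty M hR hn hfree

/-- **THE WHOLE `p = 13` ROW FOR CORES**: every `e`-free core of rank `13` on `> 18` points satisfies `RLS M 13 5`. -/
theorem c025_core_five_thirteen_all (M : Matroid α) [M.Finite]
    (hR : M.eRank = ((13 : ℕ) : ℕ∞)) (hbig : 13 + 5 < M.E.ncard)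
    (hfree : ∀ e ∈ M.E, ∃ A ⊆ M.E \ {e}, e ∉ M.closure A ∧ e ∉ M.closure ((M.E \ {e}) \ A)) : RLS M 13 5 :=
  c025_core_five_thirteen_all_of_ten_cells
    (fun M _ d hd21 hd30 hR hn hfree => c025_core_five_thirteen_mid M d hd21 hd30 hR hn hfree) M hR hbig hfree

/-- **THEOREM C₅ AT EVERY `p ≥ 14`**: `RLS M p 5` for every finite matroid and every `p ≥ 14`. -/
theorem c025_five_large_sharp14 (M : Matroid α) [M.Finite] (p : ℕ) (hp : 14 ≤ p) : RLS M p 5 :=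
  c025_five_large_of_rows 14 (by norm_num)
    (fun M _ hR hbig hfree => c025_core_five_thirteen_all M hR hbig hfree)
    (fun M _ hR hbig hfree => c025_core_five_fourteen_all M hR hbig hfree)
    (fun M _ p hp => c025_five_large_sharp15 M p hp) M p hp

end ThmN

end PercRepro
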